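import Summits.NavierStokesRegularity.NavierStokesRegularity.Theses.SqueezeCycle
import Summits.NavierStokesRegularity.NavierStokesRegularity.Theorems.SqueezeCycleExtremalElementExistsRegularity
import Summits.NavierStokesRegularity.NavierStokesRegularity.Theorems.SqueezeCycleExtremalElementExistsRescale
import Summits.NavierStokesRegularity.NavierStokesRegularity.Theorems.SqueezeCycleExtremalElementExistsExtraction
import Summits.NavierStokesRegularity.NavierStokesRegularity.Theorems.SqueezeCycleExtremalElementExistsEnergy
import Literature.Analysis.FluidPDE.LerayGaugeStrainSpectrum
import HarnessLib

/-!
# `ExtremalElementExists` (item stmt-NavierStokesRegularity-11611 of route `SqueezeCycle`)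

Summits-side theorem file closing the support item `ExtremalElementExists` of route `SqueezeCycle`
(decl `Summit.NavierStokesRegularity.NavierStokesRegularity.Theses.SqueezeCycle.ExtremalElementExists`):
in the Type-I model class `𝒦_C` — smooth divergence-free KNSS-mild ancient solutions on
`ℝ³ × (−∞, 0)` with the Type-I sup-rate `|u| ≤ C/√(−t)` and the two scale-invariant local energy
bounds — if some element has a point where the Leray-gauge middle strain eigenvalue
`Λ_u(t, x) = (−t) λ₂(sym ∇u(t, x))` exceeds `1/8`, then the supremum of `Λ` over
`𝒦_C × (−∞, 0) × ℝ³` is finite and **attained** by some element of `𝒦_C` at `(−1, 0)`.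

Proof (`exists_extremal_lerayMiddleStrain`, then the route form `extremalElementExists_proof`):

1. `𝒦_C` is `IsTypeIAncientMild C` plus the energy clause (`isTypeIAncientMild_iff`; the inline
   kernel is `oseenKernel` unfolded), and the two-frame forms of the item are literally
   `lerayMiddleStrain_le_iff` / `le_lerayMiddleStrain_iff` (Courant–Fischer, `LerayGaugeStrainSpectrum`).
2. `Λ` is `1`-Lipschitz in the gauge gradient `(−t)∇u(t, x)` (`lerayMiddleStrain_le_add_norm_sub`)
   and bounded by `(−t)‖∇u(t, x)‖`.
3. Every clause of `𝒦_C` and `Λ` are invariant under the Navier–Stokes zoom about `(0, x₀)`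
   (`SqueezeCycleExtremalElementExistsRescale`), so every value `Λ_v(t, x)` is a value
   `Λ_{v'}(−1, 0)`, which the class-uniform gradient bound of KNSS Prop. 4.1
   (`SqueezeCycleExtremalElementExistsRegularity`) bounds: the supremum `M` is finite.
4. A maximising sequence, zoomed to `(−1, 0)`, has a subsequence converging with gradients to an
   element `W` of the class (`SqueezeCycleExtremalElementExistsExtraction`, `…Energy`), and
   `Λ_W(−1, 0) = M` by step 2.
-/

noncomputable section

open MeasureTheory Set Function Filter TopologicalSpace Metric
open scoped Topology NNReal ENNReal InnerProductSpace RealInnerProductSpace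

namespace Summit.NavierStokesRegularity.NavierStokesRegularity.Theorems

open Literature.Analysis Literature.Analysis.FluidPDE

/-! ### Lipschitz continuity of the middle strain eigenvalue in the gradient -/

section Lipschitz

variable {u v : ℝ → EuclideanSpace ℝ (Fin 3) → EuclideanSpace ℝ (Fin 3)} {t : ℝ}
  {x : EuclideanSpace ℝ (Fin 3)}

/-- **The Leray-gauge middle strain eigenvalue is `1`-Lipschitz in the gauge gradient**:
`Λ_u(t, x) ≤ Λ_v(t, x) + (−t) ‖∇u(t, x) − ∇v(t, x)‖` for `t < 0` (a plane on which the form of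
`(−t)∇v` is `≤ Λ_v |·|²` carries the form of `(−t)∇u` up to the operator norm of the difference;
Courant–Fischer, `lerayMiddleStrain_le_iff`). [folklore] -/
theorem lerayMiddleStrain_le_add_norm_sub (ht : t < 0) :
    lerayMiddleStrain u t x ≤
      lerayMiddleStrain v t x + (-t) * ‖fderiv ℝ (u t) x - fderiv ℝ (v t) x‖ := by
  have ht' : 0 < -t := neg_pos.2 ht
  set D := fderiv ℝ (u t) x - fderiv ℝ (v t) x with hD
  obtain ⟨e, f, he, hf, hef, hq⟩ :=
    (lerayMiddleStrain_le_iff ht (lerayMiddleStrain v t x)).1 le_rfl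
  refine (lerayMiddleStrain_le_iff ht _).2 ⟨e, f, he, hf, hef, fun α β => ?_⟩
  set ξ := α • e + β • f with hξ
  have hnorm : ‖ξ‖ ^ 2 = α ^ 2 + β ^ 2 := norm_sq_smul_add_smul he hf hef α β
  have hsplit : fderiv ℝ (u t) x ξ = fderiv ℝ (v t) x ξ + D ξ := by
    rw [hD, _root_.sub_apply]; abel
  have hDξ : ⟪D ξ, ξ⟫_ℝ ≤ ‖D‖ * (α ^ 2 + β ^ 2) := by
    calc ⟪D ξ, ξ⟫_ℝ ≤ ‖D ξ‖ * ‖ξ‖ := real_inner_le_norm _ _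
      _ ≤ ‖D‖ * ‖ξ‖ * ‖ξ‖ := mul_le_mul_of_nonneg_right (D.le_opNorm ξ) (norm_nonneg _)
      _ = ‖D‖ * (α ^ 2 + β ^ 2) := by rw [← hnorm]; ring
  calc (-t) * ⟪fderiv ℝ (u t) x ξ, ξ⟫_ℝ
      = (-t) * ⟪fderiv ℝ (v t) x ξ, ξ⟫_ℝ + (-t) * ⟪D ξ, ξ⟫_ℝ := by rw [hsplit, inner_add_left]; ring
    _ ≤ lerayMiddleStrain v t x * (α ^ 2 + β ^ 2) + (-t) * (‖D‖ * (α ^ 2 + β ^ 2)) :=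
        add_le_add (hq α β) (mul_le_mul_of_nonneg_left hDξ ht'.le)
    _ = (lerayMiddleStrain v t x + (-t) * ‖D‖) * (α ^ 2 + β ^ 2) := by ring

/-- `|Λ_u(t, x) − Λ_v(t, x)| ≤ (−t) ‖∇u(t, x) − ∇v(t, x)‖` for `t < 0`. [folklore] -/
theorem abs_lerayMiddleStrain_sub_le (ht : t < 0) :
    |lerayMiddleStrain u t x - lerayMiddleStrain v t x| ≤
      (-t) * ‖fderiv ℝ (u t) x - fderiv ℝ (v t) x‖ := by
  rw [abs_sub_le_iff]
  constructor
  · linarith [lerayMiddleStrain_le_add_norm_sub (u := u) (v := v) (x := x) ht]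
  · have h := lerayMiddleStrain_le_add_norm_sub (u := v) (v := u) (x := x) ht
    rw [norm_sub_rev] at h
    linarith

/-- `Λ_u(t, x) ≤ (−t) ‖∇u(t, x)‖` for `t < 0` (comparison with the zero field, whose middle
strain eigenvalue vanishes). [folklore] -/
theorem lerayMiddleStrain_le_norm_fderiv (ht : t < 0) :
    lerayMiddleStrain u t x ≤ (-t) * ‖fderiv ℝ (u t) x‖ := by
  have h0 : lerayMiddleStrain
      (0 : ℝ → EuclideanSpace ℝ (Fin 3) → EuclideanSpace ℝ (Fin 3)) t x ≤ 0 := by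
    obtain ⟨e, f, he, hf, hef, -⟩ :=
      (le_lerayMiddleStrain_iff ht (lerayMiddleStrain
        (0 : ℝ → EuclideanSpace ℝ (Fin 3) → EuclideanSpace ℝ (Fin 3)) t x)).1 le_rfl
    refine (lerayMiddleStrain_le_iff ht 0).2 ⟨e, f, he, hf, hef, fun α β => ?_⟩
    simp
  have h := lerayMiddleStrain_le_add_norm_sub (u := u)
    (v := (0 : ℝ → EuclideanSpace ℝ (Fin 3) → EuclideanSpace ℝ (Fin 3))) (x := x) ht
  have hz : fderiv ℝ ((0 : ℝ → EuclideanSpace ℝ (Fin 3) → EuclideanSpace ℝ (Fin 3)) t) x = 0 := by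
    show fderiv ℝ (fun _ => (0 : EuclideanSpace ℝ (Fin 3))) x = 0
    exact fderiv_const_apply 0
  rw [hz, sub_zero] at h
  linarith

end Lipschitz

/-! ### The energy clause under the zoom -/

section EnergyZoom

/-- **The two scale-invariant energy bounds are invariant under the Navier–Stokes zoom** about
`(0, x₀)` (`scaledEnergy_zoom`, `scaledGradEnergy_zoom`: the zoomed cylinder `Q((s₀, y₀), r)`,
`s₀ ≤ 0`, is the image of `Q((c²s₀, x₀ + c y₀), c r)`, again with vertex time `≤ 0`). [folklore] -/
theorem energyBounds_zoom {C : ℝ} {u : ℝ → EuclideanSpace ℝ (Fin 3) → EuclideanSpace ℝ (Fin 3)}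
    (hu : IsTypeIAncientMild C u)
    (hen : ∀ (x₀ : EuclideanSpace ℝ (Fin 3)) (t₀ r : ℝ), t₀ ≤ 0 → 0 < r →
      (∀ t, t₀ - r ^ 2 < t → t < t₀ → r⁻¹ * ∫ x in ball x₀ r, ‖u t x‖ ^ 2 ≤ C) ∧
        r⁻¹ * ∫ t in Ioo (t₀ - r ^ 2) t₀, ∫ x in ball x₀ r, ‖fderiv ℝ (u t) x‖ ^ 2 ≤ C)
    {c : ℝ} (hc : 0 < c) (x₀ : EuclideanSpace ℝ (Fin 3)) :
    ∀ (y₀ : EuclideanSpace ℝ (Fin 3)) (s₀ r : ℝ), s₀ ≤ 0 → 0 < r →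
      (∀ s, s₀ - r ^ 2 < s → s < s₀ →
        r⁻¹ * ∫ y in ball y₀ r, ‖(c • stPull (c ^ 2) c 0 x₀ u) s y‖ ^ 2 ≤ C) ∧
        r⁻¹ * ∫ s in Ioo (s₀ - r ^ 2) s₀, ∫ y in ball y₀ r,
          ‖fderiv ℝ ((c • stPull (c ^ 2) c 0 x₀ u) s) y‖ ^ 2 ≤ C := by
  intro y₀ s₀ r hs₀ hr
  have hc2 : 0 < c ^ 2 := by positivity
  have hcr : 0 < c * r := mul_pos hc hr
  have hs₀' : c ^ 2 * s₀ ≤ 0 := mul_nonpos_of_nonneg_of_nonpos hc2.le hs₀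
  have h := hen (x₀ + c • y₀) (c ^ 2 * s₀) (c * r) hs₀' hcr
  refine ⟨fun s hs1 hs2 => ?_, ?_⟩
  · rw [scaledEnergy_zoom hc x₀ y₀ u s hr]
    exact h.1 (c ^ 2 * s) (by nlinarith) (by nlinarith)
  · rw [scaledGradEnergy_zoom hc x₀ y₀ u
      (fun t ht => (hu.contDiff_slice ht).differentiable (by simp)) hs₀ hr]
    exact h.2

end EnergyZoom

/-! ### The extremal element -/

section Extremal

/-- **The supremum of the Leray-gauge middle strain eigenvalue over the Type-I model class is
attained.** Let `u ∈ 𝒦_C` (`IsTypeIAncientMild C u` and the two local energy bounds) and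
`θ < Λ_u(t₁, x₁)` at some `t₁ < 0`. Then there are `u' ∈ 𝒦_C` and `m > θ` with
`m ≤ Λ_{u'}(−1, 0)` and `Λ_v(t, x) ≤ m` for every `v ∈ 𝒦_C`, `t < 0`, `x` (module docstring,
steps 2–4). [cite: KochNadirashviliSereginSverak2009, Prop. 4.1 and Lemma 6.1 (arXiv:0709.3599 pp. 8, 11)] -/
theorem exists_extremal_lerayMiddleStrain (C : ℝ)
    {u : ℝ → EuclideanSpace ℝ (Fin 3) → EuclideanSpace ℝ (Fin 3)} (hu : IsTypeIAncientMild C u)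
    (hen : ∀ (x₀ : EuclideanSpace ℝ (Fin 3)) (t₀ r : ℝ), t₀ ≤ 0 → 0 < r →
      (∀ t, t₀ - r ^ 2 < t → t < t₀ → r⁻¹ * ∫ x in ball x₀ r, ‖u t x‖ ^ 2 ≤ C) ∧
        r⁻¹ * ∫ t in Ioo (t₀ - r ^ 2) t₀, ∫ x in ball x₀ r, ‖fderiv ℝ (u t) x‖ ^ 2 ≤ C)
    {t₁ : ℝ} (ht₁ : t₁ < 0) {x₁ : EuclideanSpace ℝ (Fin 3)} {θ : ℝ}
    (hθ : θ < lerayMiddleStrain u t₁ x₁) :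
    ∃ u' : ℝ → EuclideanSpace ℝ (Fin 3) → EuclideanSpace ℝ (Fin 3), IsTypeIAncientMild C u' ∧
      (∀ (x₀ : EuclideanSpace ℝ (Fin 3)) (t₀ r : ℝ), t₀ ≤ 0 → 0 < r →
        (∀ t, t₀ - r ^ 2 < t → t < t₀ → r⁻¹ * ∫ x in ball x₀ r, ‖u' t x‖ ^ 2 ≤ C) ∧
          r⁻¹ * ∫ t in Ioo (t₀ - r ^ 2) t₀, ∫ x in ball x₀ r, ‖fderiv ℝ (u' t) x‖ ^ 2 ≤ C) ∧
      ∃ m : ℝ, θ < m ∧ m ≤ lerayMiddleStrain u' (-1) 0 ∧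
        ∀ v : ℝ → EuclideanSpace ℝ (Fin 3) → EuclideanSpace ℝ (Fin 3), IsTypeIAncientMild C v →
          (∀ (x₀ : EuclideanSpace ℝ (Fin 3)) (t₀ r : ℝ), t₀ ≤ 0 → 0 < r →
            (∀ t, t₀ - r ^ 2 < t → t < t₀ → r⁻¹ * ∫ x in ball x₀ r, ‖v t x‖ ^ 2 ≤ C) ∧
              r⁻¹ * ∫ t in Ioo (t₀ - r ^ 2) t₀, ∫ x in ball x₀ r, ‖fderiv ℝ (v t) x‖ ^ 2 ≤ C) →
          ∀ t < 0, ∀ x, lerayMiddleStrain v t x ≤ m := by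
  -- the energy clause as a predicate
  set En : (ℝ → EuclideanSpace ℝ (Fin 3) → EuclideanSpace ℝ (Fin 3)) → Prop := fun v =>
    ∀ (x₀ : EuclideanSpace ℝ (Fin 3)) (t₀ r : ℝ), t₀ ≤ 0 → 0 < r →
      (∀ t, t₀ - r ^ 2 < t → t < t₀ → r⁻¹ * ∫ x in ball x₀ r, ‖v t x‖ ^ 2 ≤ C) ∧
        r⁻¹ * ∫ t in Ioo (t₀ - r ^ 2) t₀, ∫ x in ball x₀ r, ‖fderiv ℝ (v t) x‖ ^ 2 ≤ C with hEn
  change En u at hen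
  -- ## the normalisation to `(-1, 0)` by the zoom about `(0, x)` with factor `√(-t)`
  have hzoom : ∀ v : ℝ → EuclideanSpace ℝ (Fin 3) → EuclideanSpace ℝ (Fin 3),
      IsTypeIAncientMild C v → En v → ∀ t < 0, ∀ x,
        ∃ v' : ℝ → EuclideanSpace ℝ (Fin 3) → EuclideanSpace ℝ (Fin 3),
          IsTypeIAncientMild C v' ∧ En v' ∧
            lerayMiddleStrain v' (-1) 0 = lerayMiddleStrain v t x := by
    intro v hv hve t ht x
    set c : ℝ := Real.sqrt (-t) with hcdef
    have hc : 0 < c := Real.sqrt_pos.2 (neg_pos.2 ht)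
    have hc2 : c ^ 2 = -t := Real.sq_sqrt (neg_pos.2 ht).le
    refine ⟨c • stPull (c ^ 2) c 0 x v, isTypeIAncientMild_zoom hv hc x,
      energyBounds_zoom hv hve hc x, ?_⟩
    have hd : Differentiable ℝ (v (c ^ 2 * (-1))) := by
      rw [hc2, show -t * (-1) = t by ring]
      exact (hv.contDiff_slice ht).differentiable (by simp)
    rw [lerayMiddleStrain_zoom hc x v (by norm_num) hd 0, smul_zero, add_zero, hc2,
      show -t * (-1) = t by ring]
  -- ## the class-uniform bound at `t = -1`, hence everywhere
  obtain ⟨K, hK⟩ := exists_norm_iteratedFDeriv_le_of_typeI C 1 (a := -3) (b := -(1 / 2)) (δ := 1)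
    (by norm_num) (by norm_num) one_pos
  have hK1 : ∀ v : ℝ → EuclideanSpace ℝ (Fin 3) → EuclideanSpace ℝ (Fin 3),
      IsTypeIAncientMild C v → lerayMiddleStrain v (-1) 0 ≤ K := by
    intro v hv
    have h := hK hv.continuousOn_uncurry (fun t ht => hv.isWeaklyDivFree ht)
      (fun s t hst ht x => hv.mild_eq_heatExtension hst ht x) hv.hasTypeITimeDecay (-1)
      ⟨by norm_num, by norm_num⟩ 0
    rw [norm_iteratedFDeriv_one] at h
    have h2 := lerayMiddleStrain_le_norm_fderiv (u := v) (x := (0 : EuclideanSpace ℝ (Fin 3)))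
      (by norm_num : (-1 : ℝ) < 0)
    rw [neg_neg, one_mul] at h2
    exact h2.trans h
  have hbound : ∀ v : ℝ → EuclideanSpace ℝ (Fin 3) → EuclideanSpace ℝ (Fin 3),
      IsTypeIAncientMild C v → En v → ∀ t < 0, ∀ x, lerayMiddleStrain v t x ≤ K := by
    intro v hv hve t ht x
    obtain ⟨v', hv', -, heq⟩ := hzoom v hv hve t ht x
    rw [← heq]
    exact hK1 v' hv'
  -- ## the supremum
  set S : Set ℝ := {Λ | ∃ (v : ℝ → EuclideanSpace ℝ (Fin 3) → EuclideanSpace ℝ (Fin 3)) (t : ℝ)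
    (x : EuclideanSpace ℝ (Fin 3)), IsTypeIAncientMild C v ∧ En v ∧ t < 0 ∧
      Λ = lerayMiddleStrain v t x} with hS
  have hSbdd : BddAbove S :=
    ⟨K, by rintro Λ ⟨v, t, x, hv, hve, ht, rfl⟩; exact hbound v hv hve t ht x⟩
  have hmemS : ∀ v t x, IsTypeIAncientMild C v → En v → t < 0 → lerayMiddleStrain v t x ∈ S :=
    fun v t x hv hve ht => ⟨v, t, x, hv, hve, ht, rfl⟩
  have hSne : S.Nonempty := ⟨_, hmemS u t₁ x₁ hu hen ht₁⟩
  set M : ℝ := sSup S with hM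
  have hle : ∀ v t x, IsTypeIAncientMild C v → En v → t < 0 → lerayMiddleStrain v t x ≤ M :=
    fun v t x hv hve ht => le_csSup hSbdd (hmemS v t x hv hve ht)
  have hθM : θ < M := hθ.trans_le (hle u t₁ x₁ hu hen ht₁)
  -- ## a maximising sequence, normalised to `(-1, 0)`
  obtain ⟨Λs, -, hΛlim, hΛmem⟩ := exists_seq_tendsto_sSup hSne hSbdd
  have hseq : ∀ k, ∃ w : ℝ → EuclideanSpace ℝ (Fin 3) → EuclideanSpace ℝ (Fin 3),
      IsTypeIAncientMild C w ∧ En w ∧ lerayMiddleStrain w (-1) 0 = Λs k := by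
    intro k
    obtain ⟨v, t, x, hv, hve, ht, hΛ⟩ := hΛmem k
    obtain ⟨v', hv', hve', heq⟩ := hzoom v hv hve t ht x
    exact ⟨v', hv', hve', by rw [heq, hΛ]⟩
  choose w hwc hwe hwΛ using hseq
  -- ## compactness
  obtain ⟨φ, hφ, W, hWc, hpt, hptG, -, -⟩ := exists_tendsto_of_isTypeIAncientMild_seq C hwc
  have hWe : En W :=
    energyBounds_of_tendsto C (fun j => hwc (φ j)) (fun j => hwe (φ j)) hWc hpt hptG
  -- ## the supremum is attained at `(-1, 0)` by `W`
  have hMW : M ≤ lerayMiddleStrain W (-1) 0 := by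
    have h1 : Tendsto (fun j => lerayMiddleStrain (w (φ j)) (-1) 0) atTop (𝓝 M) := by
      have h := hΛlim.comp hφ.tendsto_atTop
      exact h.congr fun j => by simp only [comp_apply, hwΛ]
    have h2 : Tendsto (fun j => lerayMiddleStrain W (-1) 0 +
        (-(-1 : ℝ)) * ‖fderiv ℝ (w (φ j) (-1)) 0 - fderiv ℝ (W (-1)) 0‖) atTop
        (𝓝 (lerayMiddleStrain W (-1) 0 + (-(-1 : ℝ)) * 0)) := by
      refine tendsto_const_nhds.add (Tendsto.const_mul _ ?_)
      have h := (hptG (-1) (by norm_num) 0).sub_const (fderiv ℝ (W (-1)) 0)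
      rw [sub_self] at h
      exact tendsto_norm_zero.comp h
    rw [mul_zero, add_zero] at h2
    exact le_of_tendsto_of_tendsto' h1 h2 fun j =>
      lerayMiddleStrain_le_add_norm_sub (u := w (φ j)) (v := W) (x := 0) (by norm_num)
  exact ⟨W, hWc, hWe, M, hθM, hMW, fun v hv hve t ht x => hle v t x hv hve ht⟩

end Extremal

/-! ### The route item -/

/-- **Item `ExtremalElementExists` of route `SqueezeCycle` (stmt-NavierStokesRegularity-11611).**
If some element `u` of the Type-I model class `𝒦_C` has a point `(t, x)`, `t < 0`, at which the
Leray-gauge middle strain eigenvalue is not `≤ 1/8` (two-frame Courant–Fischer form), then there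
are `u' ∈ 𝒦_C` (same `C`), `m ≥ 1/8` and `(t₀, x₀) = (−1, 0)` with `Λ_{u'}(t₀, x₀) ≥ m` and
`Λ_v(t, x) ≤ m` for every `v ∈ 𝒦_C`, `t < 0`, `x` — the supremum of `Λ` over the class is
attained (`exists_extremal_lerayMiddleStrain`; the inline class is `IsTypeIAncientMild` plus the
energy clause, `isTypeIAncientMild_iff`, and the inline two-frame forms are
`lerayMiddleStrain_le_iff` / `le_lerayMiddleStrain_iff`). [cite: KochNadirashviliSereginSverak2009, Prop. 4.1 and Lemma 6.1 (arXiv:0709.3599 pp. 8, 11); HornJohnson2013, Thm 4.2.6] -/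
theorem extremalElementExists_proof :
    Summit.NavierStokesRegularity.NavierStokesRegularity.Theses.SqueezeCycle.ExtremalElementExists := by
  unfold Summit.NavierStokesRegularity.NavierStokesRegularity.Theses.SqueezeCycle.ExtremalElementExists
  intro C u hu hviol
  obtain ⟨hsm, hdiv, hmild, hI, hen⟩ := hu
  have hu' : IsTypeIAncientMild C u := isTypeIAncientMild_iff.2 ⟨hsm, hdiv, hmild, hI⟩
  obtain ⟨t₁, ht₁, x₁, hx₁⟩ := hviol
  have hgt : (1 / 8 : ℝ) < lerayMiddleStrain u t₁ x₁ :=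
    not_le.1 fun h => hx₁ ((lerayMiddleStrain_le_iff ht₁ (1 / 8 : ℝ)).1 h)
  obtain ⟨u', hu'c, hu'e, m, hm, hmW, hmax⟩ := exists_extremal_lerayMiddleStrain C hu' hen ht₁ hgt
  obtain ⟨hsm', hdiv', hmild', hI'⟩ := isTypeIAncientMild_iff.1 hu'c
  refine ⟨u', m, -1, 0, by norm_num, ⟨hsm', hdiv', hmild', hI', hu'e⟩, hm.le,
    (le_lerayMiddleStrain_iff (by norm_num) m).1 hmW, ?_⟩
  rintro v' ⟨hvsm, hvdiv, hvmild, hvI, hve⟩ t ht x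
  have hv' : IsTypeIAncientMild C v' := isTypeIAncientMild_iff.2 ⟨hvsm, hvdiv, hvmild, hvI⟩
  exact (lerayMiddleStrain_le_iff ht m).1 (hmax v' hv' hve t ht x)

end Summit.NavierStokesRegularity.NavierStokesRegularity.Theorems

end
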